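import Mathlib
import Summits.Ventures.PercRepro2.Defs
import Summits.Ventures.PercRepro2.Graph
import Summits.Ventures.PercRepro2.OneColourSwitch
import Summits.Ventures.PercRepro2.RegionHubSign
import Summits.Ventures.PercRepro2.SideSwitch
import Summits.Ventures.PercRepro2.SideSwitchComps
import Summits.Ventures.PercRepro2.M9NoPocketDefs
import Summits.Ventures.PercRepro2.M9GeneralDSplit
import Summits.Ventures.PercRepro2.M9GeneralDHD
import Summits.Ventures.PercRepro2.M9PocketUnitKonly
import Summits.Ventures.PercRepro2.M9PocketHDTheorem
import Summits.Ventures.PercRepro2.M9PocketProdAssembly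
import Summits.Ventures.PercRepro2.M9PocketRSEdgeTransfer

/-!
# The single-`d` statement with edges inside `{r, s}` (blind cell PercRepro2, p3 g39,
2026-08-29; `proofs/P3-POCKETRK.md` §10″)

A colouring of `G` is a colouring of `G` minus the edges inside `{r, s}` (loops at `r`, `s`
and `r`–`s` edges) together with a colouring `τ` of those edges (`Equiv.piEquivPiSubtypeProd`).
By `M9PocketRSEdgeTransfer` the `K`-only `HD` status and `σ_pq` do not depend on `τ`, and the
sum over `τ` of `σ_rs` is `c · σ_rs` of the restriction, `c ≥ 0` the number of `τ` with every
`r`–`s` edge closed (`sum_sigma_rs_glue`).  Hence the `K`-half of the hub–dead-end sum of `G`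
is `c` times the one of the restricted graph (`hdK_eq_mul_restrict`), and
**`dSignSum_nonpos_of_sepN'`**: `dSignSum ≤ 0` for every graph with no `d r`, `d s` edge in
which the neighbourhood of `d` separates `r` from `s` in `G − d` — the edges inside `{r, s}`
are now arbitrary.  Own work; std axioms.
-/

namespace Summit.Ventures.PercRepro2

namespace NoPocket

open Finset Classical OneColourSwitch SideSwitch

variable {V : Type*} {E : Type*} {ends : E → Sym2 V} {p q r s d : V}

section Glue

/-- The restriction of the glued colouring is its first component. -/
lemma restrict_glue (ω' : {e // e ∉ within ends ({r, s} : Set V)} → Bool)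
    (τ : {e // ¬ (e ∉ within ends ({r, s} : Set V))} → Bool) :
    (fun e : {e // e ∉ within ends ({r, s} : Set V)} =>
      (Equiv.piEquivPiSubtypeProd (fun e => e ∉ within ends ({r, s} : Set V))
        (fun _ => Bool)).symm (ω', τ) e.1) = ω' := by
  funext e
  simp [Equiv.piEquivPiSubtypeProd_symm_apply, e.2]

/-- The glued colouring on a removed edge is its second component. -/
lemma glue_removed (ω' : {e // e ∉ within ends ({r, s} : Set V)} → Bool)
    (τ : {e // ¬ (e ∉ within ends ({r, s} : Set V))} → Bool)
    (e : {e // ¬ (e ∉ within ends ({r, s} : Set V))}) :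
    (Equiv.piEquivPiSubtypeProd (fun e => e ∉ within ends ({r, s} : Set V))
      (fun _ => Bool)).symm (ω', τ) e.1 = τ e := by
  simp [Equiv.piEquivPiSubtypeProd_symm_apply, e.2]

/-- The colour flip on a removed edge. -/
lemma compl_apply_eq_false_iff {τ : {e // ¬ (e ∉ within ends ({r, s} : Set V))} → Bool}
    (e : {e // ¬ (e ∉ within ends ({r, s} : Set V))}) :
    OneColourSwitch.compl τ e = false ↔ τ e = true := by
  cases h : τ e <;> simp [OneColourSwitch.compl, h]

/-- The colour flip on a removed edge. -/
lemma compl_apply_eq_true_iff {τ : {e // ¬ (e ∉ within ends ({r, s} : Set V))} → Bool}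
    (e : {e // ¬ (e ∉ within ends ({r, s} : Set V))}) :
    OneColourSwitch.compl τ e = true ↔ τ e = false := by
  cases h : τ e <;> simp [OneColourSwitch.compl, h]

/-- The colour flip commutes with the glue. -/
lemma compl_glue (ω' : {e // e ∉ within ends ({r, s} : Set V)} → Bool)
    (τ : {e // ¬ (e ∉ within ends ({r, s} : Set V))} → Bool) :
    OneColourSwitch.compl ((Equiv.piEquivPiSubtypeProd
        (fun e => e ∉ within ends ({r, s} : Set V)) (fun _ => Bool)).symm (ω', τ)) =
      (Equiv.piEquivPiSubtypeProd (fun e => e ∉ within ends ({r, s} : Set V))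
        (fun _ => Bool)).symm (OneColourSwitch.compl ω', OneColourSwitch.compl τ) := by
  funext e
  simp only [OneColourSwitch.compl, Equiv.piEquivPiSubtypeProd_symm_apply]
  split_ifs <;> rfl

/-- `r ~_Y s` at the glued colouring. -/
lemma conn_rs_glue_iff (ω' : {e // e ∉ within ends ({r, s} : Set V)} → Bool)
    (τ : {e // ¬ (e ∉ within ends ({r, s} : Set V))} → Bool) :
    Conn ends ((Equiv.piEquivPiSubtypeProd (fun e => e ∉ within ends ({r, s} : Set V))
        (fun _ => Bool)).symm (ω', τ)) r s ↔
      Conn (fun e : {e // e ∉ within ends ({r, s} : Set V)} => ends e.1) ω' r s ∨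
        ∃ e : {e // ¬ (e ∉ within ends ({r, s} : Set V))}, τ e = true ∧ ends e.1 = s(r, s) := by
  rw [conn_rs_restrict_iff, restrict_glue]
  constructor
  · rintro (h | ⟨e, he, hg, hends⟩)
    · exact Or.inl h
    · refine Or.inr ⟨⟨e, not_not.2 he⟩, ?_, hends⟩
      rw [← glue_removed ω' τ ⟨e, not_not.2 he⟩]
      exact hg
  · rintro (h | ⟨e, he, hends⟩)
    · exact Or.inl h
    · refine Or.inr ⟨e.1, not_not.1 e.2, ?_, hends⟩
      rw [glue_removed]
      exact he

/-- `r ~_W s` at the glued colouring. -/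
lemma conn_compl_rs_glue_iff (ω' : {e // e ∉ within ends ({r, s} : Set V)} → Bool)
    (τ : {e // ¬ (e ∉ within ends ({r, s} : Set V))} → Bool) :
    Conn ends (OneColourSwitch.compl ((Equiv.piEquivPiSubtypeProd
        (fun e => e ∉ within ends ({r, s} : Set V)) (fun _ => Bool)).symm (ω', τ))) r s ↔
      Conn (fun e : {e // e ∉ within ends ({r, s} : Set V)} => ends e.1)
          (OneColourSwitch.compl ω') r s ∨
        ∃ e : {e // ¬ (e ∉ within ends ({r, s} : Set V))}, τ e = false ∧ ends e.1 = s(r, s) := by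
  rw [compl_glue, conn_rs_glue_iff]
  constructor
  · rintro (h | ⟨e, he, hends⟩)
    · exact Or.inl h
    · exact Or.inr ⟨e, (compl_apply_eq_true_iff e).1 he, hends⟩
  · rintro (h | ⟨e, he, hends⟩)
    · exact Or.inl h
    · exact Or.inr ⟨e, (compl_apply_eq_true_iff e).2 he, hends⟩

/-- The `K`-only `HD` status of the glued colouring is that of the restriction. -/
lemma konly_glue_iff (ω' : {e // e ∉ within ends ({r, s} : Set V)} → Bool)
    (τ : {e // ¬ (e ∉ within ends ({r, s} : Set V))} → Bool) :
    (HD ends p q r s d ((Equiv.piEquivPiSubtypeProd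
        (fun e => e ∉ within ends ({r, s} : Set V)) (fun _ => Bool)).symm (ω', τ)) ∧
      d ∈ K2 ends r s ((Equiv.piEquivPiSubtypeProd
        (fun e => e ∉ within ends ({r, s} : Set V)) (fun _ => Bool)).symm (ω', τ))) ↔
    (HD (fun e : {e // e ∉ within ends ({r, s} : Set V)} => ends e.1) p q r s d ω' ∧
      d ∈ K2 (fun e : {e // e ∉ within ends ({r, s} : Set V)} => ends e.1) r s ω') := by
  have hr := restrict_glue ω' τ
  rw [HD_konly_iff, HD_konly_iff, sep2_restrict_iff, DOne_restrict_iff, K2_restrict_eq r s,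
    M2_restrict_eq r s, hr]
  constructor
  · rintro ⟨h1, h2, h3, h4, h5⟩
    refine ⟨h1, h2, h3, h4, ?_⟩
    have hM : d ∉ M2 ends r s ((Equiv.piEquivPiSubtypeProd
        (fun e => e ∉ within ends ({r, s} : Set V)) (fun _ => Bool)).symm (ω', τ)) := by
      rw [M2_restrict_eq r s, hr]; exact h4
    rw [WDefect_restrict_iff hM, hr] at h5
    exact h5
  · rintro ⟨h1, h2, h3, h4, h5⟩
    refine ⟨h1, h2, h3, h4, ?_⟩
    have hM : d ∉ M2 ends r s ((Equiv.piEquivPiSubtypeProd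
        (fun e => e ∉ within ends ({r, s} : Set V)) (fun _ => Bool)).symm (ω', τ)) := by
      rw [M2_restrict_eq r s, hr]; exact h4
    rw [WDefect_restrict_iff hM, hr]
    exact h5

end Glue

section Count

variable [Fintype E] [DecidableEq E]

/-- **The sum over the colourings of the edges inside `{r, s}` of `σ_rs`** is `c · σ_rs` of the
restriction, `c` = the number of colourings of those edges with every `r`–`s` edge closed. -/
lemma sum_sigma_rs_glue (ω' : {e // e ∉ within ends ({r, s} : Set V)} → Bool) :
    ∑ τ : ({e // ¬ (e ∉ within ends ({r, s} : Set V))} → Bool),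
      sigma ends ((Equiv.piEquivPiSubtypeProd (fun e => e ∉ within ends ({r, s} : Set V))
        (fun _ => Bool)).symm (ω', τ)) r s =
    (∑ τ : ({e // ¬ (e ∉ within ends ({r, s} : Set V))} → Bool),
      if ∃ e : {e // ¬ (e ∉ within ends ({r, s} : Set V))}, τ e = true ∧ ends e.1 = s(r, s) then
        (0 : ℤ) else 1) *
    sigma (fun e : {e // e ∉ within ends ({r, s} : Set V)} => ends e.1) ω' r s := by
  have h1 : ∀ τ : ({e // ¬ (e ∉ within ends ({r, s} : Set V))} → Bool),
      sigma ends ((Equiv.piEquivPiSubtypeProd (fun e => e ∉ within ends ({r, s} : Set V))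
        (fun _ => Bool)).symm (ω', τ)) r s =
      (if Conn (fun e : {e // e ∉ within ends ({r, s} : Set V)} => ends e.1) ω' r s ∨
          ∃ e : {e // ¬ (e ∉ within ends ({r, s} : Set V))}, τ e = true ∧ ends e.1 = s(r, s) then
        (1 : ℤ) else 0) -
      (if Conn (fun e : {e // e ∉ within ends ({r, s} : Set V)} => ends e.1)
          (OneColourSwitch.compl ω') r s ∨
          ∃ e : {e // ¬ (e ∉ within ends ({r, s} : Set V))}, τ e = false ∧ ends e.1 = s(r, s) then
        (1 : ℤ) else 0) := by
    intro τ
    unfold sigma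
    rw [if_congr (conn_rs_glue_iff ω' τ) rfl rfl, if_congr (conn_compl_rs_glue_iff ω' τ) rfl rfl]
  -- the `W` count equals the `Y` count by the colour flip of `τ`
  have h2 : ∑ τ : ({e // ¬ (e ∉ within ends ({r, s} : Set V))} → Bool),
      (if Conn (fun e : {e // e ∉ within ends ({r, s} : Set V)} => ends e.1)
          (OneColourSwitch.compl ω') r s ∨
          ∃ e : {e // ¬ (e ∉ within ends ({r, s} : Set V))}, τ e = false ∧ ends e.1 = s(r, s) then
        (1 : ℤ) else 0) =
      ∑ τ : ({e // ¬ (e ∉ within ends ({r, s} : Set V))} → Bool),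
      (if Conn (fun e : {e // e ∉ within ends ({r, s} : Set V)} => ends e.1)
          (OneColourSwitch.compl ω') r s ∨
          ∃ e : {e // ¬ (e ∉ within ends ({r, s} : Set V))}, τ e = true ∧ ends e.1 = s(r, s) then
        (1 : ℤ) else 0) := by
    rw [← Equiv.sum_comp (Function.Involutive.toPerm
      (OneColourSwitch.compl (E := {e // ¬ (e ∉ within ends ({r, s} : Set V))}))
      OneColourSwitch.compl_compl)]
    refine Finset.sum_congr rfl fun τ _ => ?_
    simp only [Function.Involutive.coe_toPerm]
    refine if_congr ?_ rfl rfl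
    refine or_congr_right ?_
    constructor
    · rintro ⟨e, he, hends⟩
      exact ⟨e, (compl_apply_eq_false_iff e).1 he, hends⟩
    · rintro ⟨e, he, hends⟩
      exact ⟨e, (compl_apply_eq_false_iff e).2 he, hends⟩
  rw [Finset.sum_congr rfl fun τ _ => h1 τ, Finset.sum_sub_distrib, h2, ← Finset.sum_sub_distrib,
    Finset.sum_mul]
  refine Finset.sum_congr rfl fun τ _ => ?_
  unfold sigma
  by_cases hO : ∃ e : {e // ¬ (e ∉ within ends ({r, s} : Set V))}, τ e = true ∧ ends e.1 = s(r, s)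
  · rw [if_pos hO, if_pos (Or.inr hO), if_pos (Or.inr hO)]
    ring
  · rw [if_neg hO]
    by_cases hY : Conn (fun e : {e // e ∉ within ends ({r, s} : Set V)} => ends e.1) ω' r s <;>
    by_cases hW : Conn (fun e : {e // e ∉ within ends ({r, s} : Set V)} => ends e.1)
        (OneColourSwitch.compl ω') r s
    · rw [if_pos (Or.inl hY), if_pos (Or.inl hW), if_pos hY, if_pos hW]; ring
    · rw [if_pos (Or.inl hY), if_neg (fun h => h.elim hW hO), if_pos hY, if_neg hW]; ring
    · rw [if_neg (fun h => h.elim hY hO), if_pos (Or.inl hW), if_neg hY, if_pos hW]; ring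
    · rw [if_neg (fun h => h.elim hY hO), if_neg (fun h => h.elim hW hO), if_neg hY, if_neg hW]
      ring

/-- **The `K`-half of the hub–dead-end sum is a non-negative multiple of the one of the graph
without the edges inside `{r, s}`.** -/
lemma hdK_eq_mul_restrict :
    (∑ ω : Config E, if HD ends p q r s d ω ∧ d ∈ K2 ends r s ω then
      sigma ends ω p q * sigma ends ω r s else 0) =
    (∑ τ : ({e // ¬ (e ∉ within ends ({r, s} : Set V))} → Bool),
      if ∃ e : {e // ¬ (e ∉ within ends ({r, s} : Set V))}, τ e = true ∧ ends e.1 = s(r, s) then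
        (0 : ℤ) else 1) *
    ∑ ω' : ({e // e ∉ within ends ({r, s} : Set V)} → Bool),
      if HD (fun e : {e // e ∉ within ends ({r, s} : Set V)} => ends e.1) p q r s d ω' ∧
          d ∈ K2 (fun e : {e // e ∉ within ends ({r, s} : Set V)} => ends e.1) r s ω' then
        sigma (fun e : {e // e ∉ within ends ({r, s} : Set V)} => ends e.1) ω' p q *
          sigma (fun e : {e // e ∉ within ends ({r, s} : Set V)} => ends e.1) ω' r s
      else 0 := by
  rw [← (Equiv.piEquivPiSubtypeProd (fun e => e ∉ within ends ({r, s} : Set V))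
    (fun _ => Bool)).symm.sum_comp, Fintype.sum_prod_type, Finset.mul_sum]
  refine Finset.sum_congr rfl fun ω' _ => ?_
  by_cases h : HD (fun e : {e // e ∉ within ends ({r, s} : Set V)} => ends e.1) p q r s d ω' ∧
      d ∈ K2 (fun e : {e // e ∉ within ends ({r, s} : Set V)} => ends e.1) r s ω'
  · rw [if_pos h]
    have hpq : ∀ τ : ({e // ¬ (e ∉ within ends ({r, s} : Set V))} → Bool),
        sigma ends ((Equiv.piEquivPiSubtypeProd
          (fun e => e ∉ within ends ({r, s} : Set V)) (fun _ => Bool)).symm (ω', τ)) p q =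
        sigma (fun e : {e // e ∉ within ends ({r, s} : Set V)} => ends e.1) ω' p q := by
      intro τ
      have h' := (konly_glue_iff (p := p) (q := q) (d := d) ω' τ).2 h
      rw [sigma_pq_restrict_eq (HD_konly_iff.1 h').1, restrict_glue]
    calc ∑ τ : ({e // ¬ (e ∉ within ends ({r, s} : Set V))} → Bool),
          (if HD ends p q r s d ((Equiv.piEquivPiSubtypeProd
              (fun e => e ∉ within ends ({r, s} : Set V)) (fun _ => Bool)).symm (ω', τ)) ∧
              d ∈ K2 ends r s ((Equiv.piEquivPiSubtypeProd
              (fun e => e ∉ within ends ({r, s} : Set V)) (fun _ => Bool)).symm (ω', τ)) then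
            sigma ends ((Equiv.piEquivPiSubtypeProd
              (fun e => e ∉ within ends ({r, s} : Set V)) (fun _ => Bool)).symm (ω', τ)) p q *
            sigma ends ((Equiv.piEquivPiSubtypeProd
              (fun e => e ∉ within ends ({r, s} : Set V)) (fun _ => Bool)).symm (ω', τ)) r s
          else 0)
        = ∑ τ : ({e // ¬ (e ∉ within ends ({r, s} : Set V))} → Bool),
          sigma (fun e : {e // e ∉ within ends ({r, s} : Set V)} => ends e.1) ω' p q *
            sigma ends ((Equiv.piEquivPiSubtypeProd
              (fun e => e ∉ within ends ({r, s} : Set V)) (fun _ => Bool)).symm (ω', τ)) r s := by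
          refine Finset.sum_congr rfl fun τ _ => ?_
          rw [if_pos ((konly_glue_iff ω' τ).2 h), hpq τ]
      _ = sigma (fun e : {e // e ∉ within ends ({r, s} : Set V)} => ends e.1) ω' p q *
            ∑ τ : ({e // ¬ (e ∉ within ends ({r, s} : Set V))} → Bool),
              sigma ends ((Equiv.piEquivPiSubtypeProd
                (fun e => e ∉ within ends ({r, s} : Set V)) (fun _ => Bool)).symm (ω', τ)) r s := by
          rw [Finset.mul_sum]
      _ = _ := by rw [sum_sigma_rs_glue]; ring
  · rw [if_neg h, mul_zero]
    refine Finset.sum_eq_zero fun τ _ => ?_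
    rw [if_neg (fun h' => h ((konly_glue_iff ω' τ).1 h'))]

end Count

section Main

variable [Fintype V] [DecidableEq V] [Fintype E] [DecidableEq E]

/-- **The single-`d` sign sum is non-positive when the neighbourhood of `d` separates `r` from
`s` in `G − d`, with ARBITRARY edges inside `{r, s}`**: no `d r`, `d s` edge, and no `r`–`s`
path of `G − d` through non-neighbours of `d`. -/
theorem dSignSum_nonpos_of_sepN' (hdr : d ≠ r) (hds : d ≠ s)
    (hT : ∀ e, ends e ≠ s(d, r) ∧ ends e ≠ s(d, s))
    (hsepN : ¬ Conn (endsD ends d) (chi (endsD ends d) {x : V | ∀ e, ends e ≠ s(d, x)}) r s) :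
    dSignSum ends p q r s d ≤ 0 := by
  refine dSignSum_nonpos_of_hdSum_nonpos hdr.symm hds.symm ?_
  rw [hdSum_eq_two_mul_hdK, hdK_eq_mul_restrict]
  refine mul_nonpos_iff.2 (Or.inl ⟨by norm_num, ?_⟩)
  refine mul_nonpos_iff.2 (Or.inl ⟨Finset.sum_nonneg fun τ _ => by split_ifs <;> norm_num, ?_⟩)
  · by_cases h : p = d ∨ q = d
    · rw [hdK_eq_zero_of_eq h]
    · rw [not_or] at h
      have hrs' : within (fun e : {e // e ∉ within ends ({r, s} : Set V)} => ends e.1)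
          ({r, s} : Set V) = ∅ := by
        ext e
        simp only [Set.mem_empty_iff_false, iff_false]
        rintro ⟨x, hx, y, hy, hxy⟩
        exact e.2 ⟨x, hx, y, hy, hxy⟩
      have hT' : ∀ e : {e // e ∉ within ends ({r, s} : Set V)},
          (fun e : {e // e ∉ within ends ({r, s} : Set V)} => ends e.1) e ≠ s(d, r) ∧
          (fun e : {e // e ∉ within ends ({r, s} : Set V)} => ends e.1) e ≠ s(d, s) :=
        fun e => hT e.1
      have hsepN' : ¬ Conn (endsD (fun e : {e // e ∉ within ends ({r, s} : Set V)} => ends e.1) d)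
          (chi (endsD (fun e : {e // e ∉ within ends ({r, s} : Set V)} => ends e.1) d)
            {x : V | ∀ e : {e // e ∉ within ends ({r, s} : Set V)},
              (fun e : {e // e ∉ within ends ({r, s} : Set V)} => ends e.1) e ≠ s(d, x)}) r s := by
        intro h'
        apply hsepN
        -- a restricted path through non-neighbours of `d` is a path of `G − d`
        have hmono : Conn (fun e : {e // e ∉ within ends ({r, s} : Set V)} => endsD ends d e.1)
            (fun e : {e // e ∉ within ends ({r, s} : Set V)} =>
              chi (endsD ends d) {x : V | ∀ e, ends e ≠ s(d, x)} e.1) r s := by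
          refine SimpleGraph.Reachable.mono ?_ h'
          intro u v huv
          rw [openGraph_adj] at huv ⊢
          obtain ⟨hne, e, he, hends⟩ := huv
          refine ⟨hne, e, ?_, hends⟩
          rw [chi_eq_true_iff] at he ⊢
          obtain ⟨x, hx, y, hy, hxy⟩ := he
          have key : ∀ z : V, (∀ e' : {e // e ∉ within ends ({r, s} : Set V)},
              ends e'.1 ≠ s(d, z)) → ∀ e', ends e' ≠ s(d, z) := by
            intro z hz e' hz'
            by_cases hP : e' ∉ within ends ({r, s} : Set V)
            · exact hz ⟨e', hP⟩ hz'
            · rw [not_not] at hP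
              rcases (endpoint_of_mem_within hP hz').1 with h1 | h1
              · exact hdr h1
              · exact hds h1
          exact ⟨x, key x hx, y, key y hy, hxy⟩
        exact conn_of_conn_restrict (P := fun e => e ∉ within ends ({r, s} : Set V))
          (ends := endsD ends d) (ω := chi (endsD ends d) {x : V | ∀ e, ends e ≠ s(d, x)}) hmono
      exact hdK_nonpos_of_noLinking hdr hds hrs' hT' h.1 h.2 (noLinking_of_sepN hdr hds hT' hsepN')

/-- **The same with the separation hypothesis on `G` minus the edges inside `{r, s}`** — the
honest form when `r`–`s` edges are present (a direct `r`–`s` edge is itself a path of `G − d`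
avoiding the neighbours of `d`, so `dSignSum_nonpos_of_sepN'` is void for such graphs): no
`r`–`s` path of `G − d` made of edges not inside `{r, s}` runs through non-neighbours of `d`
(the non-neighbours of `d` are the same in `G` and in `G` minus those edges, `d ≠ r, s`). -/
theorem dSignSum_nonpos_of_sepN_restrict (hdr : d ≠ r) (hds : d ≠ s)
    (hT : ∀ e, ends e ≠ s(d, r) ∧ ends e ≠ s(d, s))
    (hsepN : ¬ Conn (endsD (fun e : {e // e ∉ within ends ({r, s} : Set V)} => ends e.1) d)
      (chi (endsD (fun e : {e // e ∉ within ends ({r, s} : Set V)} => ends e.1) d)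
        {x : V | ∀ e : {e // e ∉ within ends ({r, s} : Set V)}, ends e.1 ≠ s(d, x)}) r s) :
    dSignSum ends p q r s d ≤ 0 := by
  refine dSignSum_nonpos_of_hdSum_nonpos hdr.symm hds.symm ?_
  rw [hdSum_eq_two_mul_hdK, hdK_eq_mul_restrict]
  refine mul_nonpos_iff.2 (Or.inl ⟨by norm_num, ?_⟩)
  refine mul_nonpos_iff.2 (Or.inl ⟨Finset.sum_nonneg fun τ _ => by split_ifs <;> norm_num, ?_⟩)
  by_cases h : p = d ∨ q = d
  · rw [hdK_eq_zero_of_eq h]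
  · rw [not_or] at h
    have hrs' : within (fun e : {e // e ∉ within ends ({r, s} : Set V)} => ends e.1)
        ({r, s} : Set V) = ∅ := by
      ext e
      simp only [Set.mem_empty_iff_false, iff_false]
      rintro ⟨x, hx, y, hy, hxy⟩
      exact e.2 ⟨x, hx, y, hy, hxy⟩
    have hT' : ∀ e : {e // e ∉ within ends ({r, s} : Set V)},
        (fun e : {e // e ∉ within ends ({r, s} : Set V)} => ends e.1) e ≠ s(d, r) ∧
        (fun e : {e // e ∉ within ends ({r, s} : Set V)} => ends e.1) e ≠ s(d, s) :=
      fun e => hT e.1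
    exact hdK_nonpos_of_noLinking hdr hds hrs' hT' h.1 h.2 (noLinking_of_sepN hdr hds hT' hsepN)

end Main

end NoPocket

end Summit.Ventures.PercRepro2
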